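/-
Origin: expansion seat `planner-pub-hodgecm-mc-axioms-1-g14-0`, handover #W60 2026-08-20T15:53:55Z md5 12333ef16384 (PKG cd4fb7812b17 → 12333ef16384; 419 l.; MECHANICAL (iib-R) rewrite v3.1 of the PKG file as it stands (32 token edits; rules R1x1+RX[h₂']x31)) (`HOME/mc/pub-hodgecm-mc-axioms-1-g14/revendor/kit-r55/stage55/HodgeCM/Model/ArchKTypeOfSlotAt34.lean`, md5 12333ef16384, 419 lines);
landed by the gen-22 packager (p-g22) in gate run 55 REPLACES the earlier landed copy of `HodgeCM/Model/ArchKTypeOfSlotAt34.lean` (seat copy carried the packager Origin header of an earlier run (stripped)).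
-/
/-
Copyright (c) 2026. Released under Apache 2.0 license as described in the file LICENSE.
Cell pub-hodgecm, MODEL layer (construction prover mc-carch-1, gen 4), BINDER-OWNERS row 12 `C` for the conjugated-plane lines k = 2, 3
in binder-1's CENTRE-FREE currency `ArchKTypeDataAt` (#51), for row 17's (W-0-supply).
-/
import Summits.HodgeConjecture.HodgeCM.Model.ArchKTypeOfAt
import Summits.HodgeConjecture.HodgeCM.Model.ArchKTypeOfSlotRecChar34

/-!
# Lines 2 and 3 AT AN ARBITRARY RATIONAL CENTRE: `archKTypeOfSlotTwoAtG/ThreeAtG … xr N`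

For every rational centre `xr : Fin 3 → L⁺` and level `N`, the G term (four twist characters, side `archSideOfChar …`) of the lines
`d₂ = dW' c.D 0`, `d₃ = dW' c.D 1` in binder-1's currency `ArchKTypeDataAt … k (finEmb xr) (N)` (thin coset `finEmb xr + (N)𝒪̂³`):
`Φarch = blockFamilyOfAt … eR eS (degOnePDual Empty) Φ₂` (both degree-one `ι₁` letters `⟨e_a,·⟩` ⊗ `Φ₂` elsewhere, via `proj a`),
`ωinf = lineOmega_two/three` (rfl), `Γ₀` an ARGUMENT (common for any finite family of `(xr, N)`), at the exponent tuples of record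
`lineVacExponentsTwo/Three`; inputs {`hlevel`, `harch`/`hfin` AT `xr`, `hsec`, `hχ`}.  Rows 14/15 along `twistU21 ∘ expP` with no further
hypothesis (`…_twistG`, via the `ArchKTypeDataAt` junction lemmas of `ArchKTypeOfAt`) and along `expP` itself under `(mk ι₁).embedding = ι₁`
(`…_of_embedding_eqG`).
Nothing is cited and nothing is minted; 0 records, 0 `def … : Prop`.
-/

set_option autoImplicit false

noncomputable section

open Filter Topology Complex
open NumberField NumberField.InfinitePlace NumberField.mixedEmbedding IsDedekindDomain MeasureTheory
open scoped Matrix TensorProduct Classical SchwartzMap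
open MulAction
open Literature.Geometry.ComplexHyperbolic.BallModel (U21 x₀ stabilizerEquivK21)
open Literature.NumberTheory.Automorphic.U21 (K21 matA sclD pPlus pPlus_apply)
open Literature.AlgebraicGeometry.HodgeTheory
open Literature.AlgebraicGeometry.ShimuraVarieties Literature.AlgebraicGeometry.ShimuraVarieties.BallForms
open Literature.NumberTheory.Automorphic Literature.NumberTheory.Weil1964
open Literature.RepresentationTheory.HeisenbergGroup (polar Heisenberg symplecticGroup ofSymplectic)
open Literature.RepresentationTheory.KonnoKonno2007 Literature.RepresentationTheory.KonnoKonno2007.RealDualPair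
open Literature.NumberTheory.GelbartRogawski1991 Literature.NumberTheory.GelbartRogawski1991.UnitaryDualPair
open Literature.Analysis.SegalBargmann Literature.Analysis.Distribution
open Literature.NumberTheory.Automorphic.PicardCM
open HodgeCM.Adelic HodgeCM.PerL34 HodgeCM.Model.HypCensus HodgeCM.Model.SupplyInstance HodgeCM.Model.ArchSideTerm

namespace HodgeCM.Model
/-! ## Lines 2 and 3 at an arbitrary centre, G pins -/

section Slot

variable (hHD : exists_isReal_hodgeModel) (hI : hodgePQ_independent_of_hodgeModel)
  (h₁ : BallQuotientUniformised)  (h₃ : CMAbelianVarietyRealised)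

variable {L : CMField} {ι₁ : L →+* ℂ} (V : HermSpace3 L ι₁) (c : SeesawCtx L)
  (hGR : (cmSplittingDatum (L : Type) finProdFinEquiv (frameD V) (frameD_real V) (frameD_ne V) (dW c.D) (dW_real c.D)
    (dW_ne c.D)).CompatibleSplitting)
  (hGR₀ : (cmSplittingDatum (L : Type) (e₁) (frameD V) (frameD_real V) (frameD_ne V) (lineVec (L : Type) (dW c.D 0))
    (fun _ => dW_real c.D 0) (fun _ => dW_ne c.D 0)).CompatibleSplitting)
  (hGR₁ : (cmSplittingDatum (L : Type) (e₁) (frameD V) (frameD_real V) (frameD_ne V) (lineVec (L : Type) (dW c.D 1))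
    (fun _ => dW_real c.D 1) (fun _ => dW_ne c.D 1)).CompatibleSplitting)
  (hGR₂ : (cmSplittingDatum (L : Type) (e₁) (frameD V) (frameD_real V) (frameD_ne V) (lineVec (L : Type) (dW' c.D 0))
    (fun _ => dW'_real c.D 0) (fun _ => dW'_ne c.D 0)).CompatibleSplitting)
  (hGR₃ : (cmSplittingDatum (L : Type) (e₁) (frameD V) (frameD_real V) (frameD_ne V) (lineVec (L : Type) (dW' c.D 1))
    (fun _ => dW'_real c.D 1) (fun _ => dW'_ne c.D 1)).CompatibleSplitting)
  (η₀ η₁ η₂ η₃ : CMAdelic (L : Type) (frameD V) × CMAdelicOne (L : Type) →* ℂˣ)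
  (hmaj : ∀ k : Fin 4, HasThetaMajorants fun (p : ↥(regimeSubgroup L V.Hm) × ↥(NumberField.relNormOneIdeles (↥(maximalRealSubfield L)) L))
      (φ : piSchwartzBruhat (↥(maximalRealSubfield L)) (Fin 3)) => lineRepOf V c.D hGR hGR₀ hGR₁ hGR₂ hGR₃ η₀ η₁ η₂ η₃ k p φ)
  (hrat : ∀ k : Fin 4, ∀ γ ∈ (V.latticeModel printFact_unitaryCompact_holds).Γ,
      ∀ t ∈ NumberField.relNormOneRat (↥(maximalRealSubfield L)) L,
        lineRepOf V c.D hGR hGR₀ hGR₁ hGR₂ hGR₃ η₀ η₁ η₂ η₃ k (γ, t) ∈ thetaStabilizerEnd (↥(maximalRealSubfield L)) (Fin 3))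
  (h₁W : (∀ j, 0 < (ι₁ (dW c.D j)).re) ∨ ∀ j, (ι₁ (dW c.D j)).re < 0)
  (A : ∀ k : Fin 4, ArchLineInput V (lineRepOf V c.D hGR hGR₀ hGR₁ hGR₂ hGR₃ η₀ η₁ η₂ η₃ k))
  (hV : IsAnisotropic L V.Hm) (N : ℕ) (Γ₀ : Level V)
  (hlevel : ∀ δ ∈ levelImage hHD hI h₁ h₃ Γ₀ hV, ∃ x : (V.latticeModel printFact_unitaryCompact_holds).G,
    x ∈ (satLevelRegimeOf V hV Γ₀.K : Subgroup (V.latticeModel printFact_unitaryCompact_holds).G) ∧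
      (archSideOfChar V c hGR hGR₀ hGR₁ hGR₂ hGR₃ η₀ η₁ η₂ η₃ hmaj hrat A).ιinf δ * x ∈ (V.latticeModel printFact_unitaryCompact_holds).Γ)
  (Φ₂ : SchwartzMap ((Fin 3 × {v : {v : InfinitePlace ↥(maximalRealSubfield L) // v.IsReal} // v ≠ cmPlace (L : Type) ι₁}) → ℝ) ℂ)

/-! ### line 2 at an arbitrary centre -/

section TwoAt

variable
  (eR : PosIdx (cmXW (L : Type) (frameD V) (lineVec (L : Type) (dW' c.D 0)) (fun _ => dW'_real c.D 0) ι₁ (cmPlace (L : Type) ι₁)) ≃ Unit)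
  (eS : NegIdx (cmXW (L : Type) (frameD V) (lineVec (L : Type) (dW' c.D 0)) (fun _ => dW'_real c.D 0) ι₁ (cmPlace (L : Type) ι₁)) ≃ Empty)
  (xr : Fin 3 → ↥(maximalRealSubfield L))
  (harch : ∀ a : UnitaryGroup.arch (↥(maximalRealSubfield L)) L (IsCMField.complexConj L) 3 V.Hm,
    UnitaryGroup.archAt (↥(maximalRealSubfield L)) L (IsCMField.complexConj L) 3 V.Hm (UnitaryGroup.cmPlace (L : Type) ι₁)
        (NumberField.complexConj_smul_infinitePlace (L : Type) _) (IsCMField.complexConj_ne_one (L : Type)) a = 1 →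
    ∀ ℓ, ((archSideOfChar V c hGR hGR₀ hGR₁ hGR₂ hGR₃ η₀ η₁ η₂ η₃ hmaj hrat A).P 2).ω
        (HodgeCM.Adelic.regimeEquiv L V.Hm hV
          (UnitaryGroup.archToAdelic (↥(maximalRealSubfield L)) L (IsCMField.complexConj L) 3 V.Hm a), 1)
        (testFun (↥(maximalRealSubfield L)) (Fin 3)
          (blockFamilyOfAt (L : Type) e₁ (frameD V) (frameD_real V) (frameD_ne V) (lineVec (L : Type) (dW' c.D 0))
            (fun _ => dW'_real c.D 0) (fun _ => dW'_ne c.D 0) ι₁ (blockPosEquiv V) (blockNegEquiv V) eR eS (degOnePDual Empty) Φ₂ ℓ)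
          xr N) =
      testFun (↥(maximalRealSubfield L)) (Fin 3)
        (blockFamilyOfAt (L : Type) e₁ (frameD V) (frameD_real V) (frameD_ne V) (lineVec (L : Type) (dW' c.D 0))
          (fun _ => dW'_real c.D 0) (fun _ => dW'_ne c.D 0) ι₁ (blockPosEquiv V) (blockNegEquiv V) eR eS (degOnePDual Empty) Φ₂ ℓ) xr N)
  (hfin : ∀ kf : UnitaryGroup.finAdelic (↥(maximalRealSubfield L)) L (IsCMField.complexConj L) 3 V.Hm, kf ∈ Γ₀.K →
    ∀ Φinf : 𝓢((Fin 3 → mixedSpace (↥(maximalRealSubfield L))), ℂ),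
      ((archSideOfChar V c hGR hGR₀ hGR₁ hGR₂ hGR₃ η₀ η₁ η₂ η₃ hmaj hrat A).P 2).ω
          (HodgeCM.Adelic.regimeEquiv L V.Hm hV
            (UnitaryGroup.finAdelicToAdelic (↥(maximalRealSubfield L)) L (IsCMField.complexConj L) 3 V.Hm kf), 1)
          (testFun (↥(maximalRealSubfield L)) (Fin 3) Φinf xr N) =
        testFun (↥(maximalRealSubfield L)) (Fin 3) Φinf xr N)
  (hsec : ∀ u : stabilizer U21 x₀,
    cmBlockSectionAt (L : Type) (frameD V) (frameD_real V) (frameD_ne V) (lineVec (L : Type) (dW' c.D 0)) (fun _ => dW'_real c.D 0)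
        (fun _ => dW'_ne c.D 0) ι₁ (cmPlace (L : Type) ι₁) (blockPosEquiv V) (blockNegEquiv V) eR eS (u21FrameEquiv (u : U21), 1) =
      (archSectionFrameOf V u, 1))
  (hχ : ∀ u : stabilizer U21 x₀,
    ((lineScalar_two V c.D hGR hGR₂ hGR₃ η₂ (u : U21) : ℂˣ) : ℂ) *
        ((matA (stabilizerEquivK21.symm u)).det ^ (lineVacExponentsTwo V c hGR₂ eR eS).eP *
          sclD (stabilizerEquivK21.symm u) ^ (lineVacExponentsTwo V c hGR₂ eR eS).eQ) =
      star (sclD (stabilizerEquivK21.symm u)))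

/-- **ROW 12 FOR LINE 2 IN THE LITERAL SLOT** — `Φarch := blockFamilyOfAt … eR eS (degOnePDual Empty) Φ₂`; (Φ) discharged. -/
def archKTypeOfSlotTwoAtG :
    ArchKTypeDataAt (thetaSpaceInputIn hHD hI h₁ h₃ (archSideOfChar V c hGR hGR₀ hGR₁ hGR₂ hGR₃ η₀ η₁ η₂ η₃ hmaj hrat A) hV) 2
      (finEmb (↥(maximalRealSubfield L)) (Fin 3) xr) (Ideal.span {((N : ℕ) : 𝓞 (↥(maximalRealSubfield L)))}) :=
  archKTypeOfAt hHD hI h₁ h₃ (archSideOfChar V c hGR hGR₀ hGR₁ hGR₂ hGR₃ η₀ η₁ η₂ η₃ hmaj hrat A) hV 2 xr N Γ₀ Γ₀.K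
    (satLevelRegimeOf_le_archFinOf V hV Γ₀.K) hlevel (fun _ hg => hg)
    (lineOmega_two V c.D hGR hGR₂ hGR₃ η₂)
    (fun g => lineRepOf_two_archInfOf_eq V c.D hGR hGR₀ hGR₁ hGR₂ hGR₃ η₀ η₁ η₂ η₃ hV g)
    (blockFamilyOfAt (L : Type) e₁ (frameD V) (frameD_real V) (frameD_ne V) (lineVec (L : Type) (dW' c.D 0)) (fun _ => dW'_real c.D 0)
      (fun _ => dW'_ne c.D 0) ι₁ (blockPosEquiv V) (blockNegEquiv V) eR eS (degOnePDual Empty) Φ₂)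
    (satLevel_fix_of_arch_of_fin_family (archSideOfChar V c hGR hGR₀ hGR₁ hGR₂ hGR₃ η₀ η₁ η₂ η₃ hmaj hrat A) hV 2 Γ₀.K
      (fun ℓ => testFun (↥(maximalRealSubfield L)) (Fin 3)
        (blockFamilyOfAt (L : Type) e₁ (frameD V) (frameD_real V) (frameD_ne V) (lineVec (L : Type) (dW' c.D 0)) (fun _ => dW'_real c.D 0)
      (fun _ => dW'_ne c.D 0) ι₁ (blockPosEquiv V) (blockNegEquiv V) eR eS (degOnePDual Empty) Φ₂ ℓ) xr N)
      harch (fun kf hkf _ => hfin kf hkf _))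
    (smulPull_blockFamilyOfAt_harm V e₁ (lineVec (L : Type) (dW' c.D 0)) (fun _ => dW'_real c.D 0) (fun _ => dW'_ne c.D 0) hGR₂
      (lineScalar_two V c.D hGR hGR₂ hGR₃ η₂) eR eS (degOnePDual Empty) Φ₂ hsec
      (fun kk Φ => cmBlockRepAt_κ_tensorPi_lineVacExponentsTwo V c hGR₂ eR eS kk Φ Φ₂)
      (unitaryOpPi_dualPairι_degOnePDual Empty) hχ)

/-- `ωinf` of the slot term is `lineOmega_two` (#CA1v4 `archKTypeOf_ωinf_apply`). -/
theorem archKTypeOfSlotTwoAt_ωinf_applyG (g : U21) (Φ : 𝓢((Fin 3 → mixedSpace (↥(maximalRealSubfield L))), ℂ)) :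
    (archKTypeOfSlotTwoAtG hHD hI h₁ h₃ V c hGR hGR₀ hGR₁ hGR₂ hGR₃ η₀ η₁ η₂ η₃ hmaj hrat A hV N Γ₀ hlevel Φ₂ eR eS xr harch hfin
        hsec hχ).ωinf g Φ = lineOmega_two V c.D hGR hGR₂ hGR₃ η₂ g Φ :=
  rfl

/-- `Φarch` of the slot term (rfl). -/
theorem archKTypeOfSlotTwoAt_ΦarchG :
    (archKTypeOfSlotTwoAtG hHD hI h₁ h₃ V c hGR hGR₀ hGR₁ hGR₂ hGR₃ η₀ η₁ η₂ η₃ hmaj hrat A hV N Γ₀ hlevel Φ₂ eR eS xr harch hfin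
        hsec hχ).Φarch =
      blockFamilyOfAt (L : Type) e₁ (frameD V) (frameD_real V) (frameD_ne V) (lineVec (L : Type) (dW' c.D 0)) (fun _ => dW'_real c.D 0)
        (fun _ => dW'_ne c.D 0) ι₁ (blockPosEquiv V) (blockNegEquiv V) eR eS (degOnePDual Empty) Φ₂ :=
  rfl

/-- the intertwining identity `hτ` of BRICK 4 for the slot term along `twistU21 ∘ expP`, `τ := F⁻¹`. -/
theorem archKTypeOfSlotTwoAt_hτG (b : Fin 2 → ℂ)
    (x : SchwartzMap (DPIdx (Fin 2) Unit Unit Empty ⊕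
      (Fin 3 × {w : {w : InfinitePlace ↥(maximalRealSubfield L) // w.IsReal} // w ≠ cmPlace (L : Type) ι₁}) → ℝ) ℂ) :
    (archKTypeOfSlotTwoAtG hHD hI h₁ h₃ V c hGR hGR₀ hGR₁ hGR₂ hGR₃ η₀ η₁ η₂ η₃ hmaj hrat A hV N Γ₀ hlevel Φ₂ eR eS xr harch hfin
        hsec hχ).ωinf (twistU21 L ι₁ (BallForms.expP b))
        (((cmBlockFrameAt (L : Type) e₁ (frameD V) (frameD_real V) (frameD_ne V) (lineVec (L : Type) (dW' c.D 0))
          (fun _ => dW'_real c.D 0) (fun _ => dW'_ne c.D 0) ι₁ (cmPlace (L : Type) ι₁) (blockPosEquiv V) (blockNegEquiv V) eR eS).symm :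
            _ ≃L[ℂ] _) x) =
      ((cmBlockFrameAt (L : Type) e₁ (frameD V) (frameD_real V) (frameD_ne V) (lineVec (L : Type) (dW' c.D 0))
          (fun _ => dW'_real c.D 0) (fun _ => dW'_ne c.D 0) ι₁ (cmPlace (L : Type) ι₁) (blockPosEquiv V) (blockNegEquiv V) eR eS).symm :
            _ ≃L[ℂ] _)
        (cmBlockRepAt (L : Type) e₁ (frameD V) (frameD_real V) (frameD_ne V) (lineVec (L : Type) (dW' c.D 0)) (fun _ => dW'_real c.D 0)
          (fun _ => dW'_ne c.D 0) hGR₂ ι₁ (cmPlace (L : Type) ι₁) (blockPosEquiv V) (blockNegEquiv V) eR eS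
          (cmBlockSectionAt (L : Type) (frameD V) (frameD_real V) (frameD_ne V) (lineVec (L : Type) (dW' c.D 0))
            (fun _ => dW'_real c.D 0) (fun _ => dW'_ne c.D 0) ι₁ (cmPlace (L : Type) ι₁) (blockPosEquiv V) (blockNegEquiv V) eR eS
            (((u21FrameEquiv (BallForms.expP b) : UForm (Fin 2) Unit), (1 : UForm Unit Empty)) : Ginf (Fin 2) Unit Unit Empty)) x) := by
  rw [archKTypeOfSlotTwoAt_ωinf_applyG, lineOmega_two_twistU21_expP_AtG, cmArchWeilRep_cmBlockFrameAt_symm]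

set_option backward.isDefEq.respectTransparency false in
/-- **ROW 14 FOR LINE 2 IN THE LITERAL SLOT — NO HYPOTHESIS BEYOND THE TERM'S INPUTS.** -/
theorem isWeaklyPDiff_archKTypeOfSlotTwoAt_twistG :
    (archKTypeOfSlotTwoAtG hHD hI h₁ h₃ V c hGR hGR₀ hGR₁ hGR₂ hGR₃ η₀ η₁ η₂ η₃ hmaj hrat A hV N Γ₀ hlevel Φ₂ eR eS xr harch hfin
        hsec hχ).IsWeaklyPDiff (fun b => twistU21 L ι₁ (BallForms.expP b)) := by
  obtain ⟨ω₁, hW₁, hc₁⟩ := exists_isArchWeilDatum_lineSlot (R := Unit) (S := Empty)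
  obtain ⟨ev₁, hvac₁⟩ := (junction (Fin 2) Unit Unit Empty).exists_vacExponents hW₁
  exact ArchKTypeDataAt.isWeaklyPDiff_of_blockPair
    (X := thetaSpaceInputIn hHD hI h₁ h₃ (archSideOfChar V c hGR hGR₀ hGR₁ hGR₂ hGR₃ η₀ η₁ η₂ η₃ hmaj hrat A) hV) _
    (isArchWeilDatum_cmBlockAt (L : Type) e₁ (frameD V) (frameD_real V) (frameD_ne V) (lineVec (L : Type) (dW' c.D 0))
      (fun _ => dW'_real c.D 0) (fun _ => dW'_ne c.D 0) hGR₂ ι₁ (cmPlace (L : Type) ι₁) (blockPosEquiv V) (blockNegEquiv V) eR eS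
      (frameD_sign_ι₁' V) (line_hs₁W_of_real (dW'_real c.D 0) (dW'_ne c.D 0)) (frameD_sign_of_ne V) (fun τ hτ => line_hsW (dW' c.D 0) τ hτ))
    (continuous_cmBlockRepAt (L : Type) e₁ (frameD V) (frameD_real V) (frameD_ne V) (lineVec (L : Type) (dW' c.D 0))
      (fun _ => dW'_real c.D 0) (fun _ => dW'_ne c.D 0) hGR₂ ι₁ (cmPlace (L : Type) ι₁) (blockPosEquiv V) (blockNegEquiv V) eR eS)
    hW₁ hc₁ hvac₁
    (cmBlockSectionAt (L : Type) (frameD V) (frameD_real V) (frameD_ne V) (lineVec (L : Type) (dW' c.D 0)) (fun _ => dW'_real c.D 0)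
      (fun _ => dW'_ne c.D 0) ι₁ (cmPlace (L : Type) ι₁) (blockPosEquiv V) (blockNegEquiv V) eR eS)
    (continuous_cmBlockSectionAt (L : Type) (frameD V) (frameD_real V) (frameD_ne V) (lineVec (L : Type) (dW' c.D 0))
      (fun _ => dW'_real c.D 0) (fun _ => dW'_ne c.D 0) ι₁ (cmPlace (L : Type) ι₁) (blockPosEquiv V) (blockNegEquiv V) eR eS)
    (coe_cmBlockPhaseHomAt_cmBlockSectionAt (L : Type) e₁ (frameD V) (frameD_real V) (frameD_ne V) (lineVec (L : Type) (dW' c.D 0))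
      (fun _ => dW'_real c.D 0) (fun _ => dW'_ne c.D 0) ι₁ (cmPlace (L : Type) ι₁) (blockPosEquiv V) (blockNegEquiv V) eR eS)
    (fun b => twistU21 L ι₁ (BallForms.expP b))
    ((cmBlockFrameAt (L : Type) e₁ (frameD V) (frameD_real V) (frameD_ne V) (lineVec (L : Type) (dW' c.D 0)) (fun _ => dW'_real c.D 0)
      (fun _ => dW'_ne c.D 0) ι₁ (cmPlace (L : Type) ι₁) (blockPosEquiv V) (blockNegEquiv V) eR eS).symm.toContinuousLinearMap)
    (archKTypeOfSlotTwoAt_hτG hHD hI h₁ h₃ V c hGR hGR₀ hGR₁ hGR₂ hGR₃ η₀ η₁ η₂ η₃ hmaj hrat A hV N Γ₀ hlevel Φ₂ eR eS xr harch hfin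
      hsec hχ)
    Φ₂ (degOnePDual Empty) (fun _ => rfl)

set_option backward.isDefEq.respectTransparency false in
/-- **ROW 15 FOR LINE 2 IN THE LITERAL SLOT ALONG `twistU21 ∘ expP` — NO HYPOTHESIS BEYOND THE TERM'S INPUTS** (`hf` = § 4);
the `expP` form is the (TWIST-2) item. -/
theorem isPMinusKilledAlong_archKTypeOfSlotTwoAt_twistG (p : Fin 2) :
    (archKTypeOfSlotTwoAtG hHD hI h₁ h₃ V c hGR hGR₀ hGR₁ hGR₂ hGR₃ η₀ η₁ η₂ η₃ hmaj hrat A hV N Γ₀ hlevel Φ₂ eR eS xr harch hfin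
        hsec hχ).IsPMinusKilledAlong (fun b => twistU21 L ι₁ (BallForms.expP b)) (-Complex.I • (Pi.single p 1 : Fin 2 → ℂ)) := by
  obtain ⟨ω₁, hW₁, hc₁⟩ := exists_isArchWeilDatum_lineSlot (R := Unit) (S := Empty)
  exact ArchKTypeDataAt.isPMinusKilledAlong_of_blockPair
    (X := thetaSpaceInputIn hHD hI h₁ h₃ (archSideOfChar V c hGR hGR₀ hGR₁ hGR₂ hGR₃ η₀ η₁ η₂ η₃ hmaj hrat A) hV) _
    (isArchWeilDatum_cmBlockAt (L : Type) e₁ (frameD V) (frameD_real V) (frameD_ne V) (lineVec (L : Type) (dW' c.D 0))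
      (fun _ => dW'_real c.D 0) (fun _ => dW'_ne c.D 0) hGR₂ ι₁ (cmPlace (L : Type) ι₁) (blockPosEquiv V) (blockNegEquiv V) eR eS
      (frameD_sign_ι₁' V) (line_hs₁W_of_real (dW'_real c.D 0) (dW'_ne c.D 0)) (frameD_sign_of_ne V) (fun τ hτ => line_hsW (dW' c.D 0) τ hτ))
    (continuous_cmBlockRepAt (L : Type) e₁ (frameD V) (frameD_real V) (frameD_ne V) (lineVec (L : Type) (dW' c.D 0))
      (fun _ => dW'_real c.D 0) (fun _ => dW'_ne c.D 0) hGR₂ ι₁ (cmPlace (L : Type) ι₁) (blockPosEquiv V) (blockNegEquiv V) eR eS)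
    hW₁ hc₁
    (cmBlockSectionAt (L : Type) (frameD V) (frameD_real V) (frameD_ne V) (lineVec (L : Type) (dW' c.D 0)) (fun _ => dW'_real c.D 0)
      (fun _ => dW'_ne c.D 0) ι₁ (cmPlace (L : Type) ι₁) (blockPosEquiv V) (blockNegEquiv V) eR eS)
    (continuous_cmBlockSectionAt (L : Type) (frameD V) (frameD_real V) (frameD_ne V) (lineVec (L : Type) (dW' c.D 0))
      (fun _ => dW'_real c.D 0) (fun _ => dW'_ne c.D 0) ι₁ (cmPlace (L : Type) ι₁) (blockPosEquiv V) (blockNegEquiv V) eR eS)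
    (coe_cmBlockPhaseHomAt_cmBlockSectionAt (L : Type) e₁ (frameD V) (frameD_real V) (frameD_ne V) (lineVec (L : Type) (dW' c.D 0))
      (fun _ => dW'_real c.D 0) (fun _ => dW'_ne c.D 0) ι₁ (cmPlace (L : Type) ι₁) (blockPosEquiv V) (blockNegEquiv V) eR eS)
    (fun b => twistU21 L ι₁ (BallForms.expP b))
    ((cmBlockFrameAt (L : Type) e₁ (frameD V) (frameD_real V) (frameD_ne V) (lineVec (L : Type) (dW' c.D 0)) (fun _ => dW'_real c.D 0)
      (fun _ => dW'_ne c.D 0) ι₁ (cmPlace (L : Type) ι₁) (blockPosEquiv V) (blockNegEquiv V) eR eS).symm.toContinuousLinearMap)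
    (archKTypeOfSlotTwoAt_hτG hHD hI h₁ h₃ V c hGR hGR₀ hGR₁ hGR₂ hGR₃ η₀ η₁ η₂ η₃ hmaj hrat A hV N Γ₀ hlevel Φ₂ eR eS xr harch hfin
      hsec hχ)
    Φ₂ (degOnePDual Empty) (fun _ => rfl) (hypOpGen_add_I_smul_rotBoostGen_degOnePDual Empty) p


/-- **ROW 14 FOR LINE 2 AT THE CENTRE `xr`, ALONG `expP` ITSELF**, in the branch `(mk ι₁).embedding = ι₁` (`twistU21 = id`). -/
theorem isWeaklyPDiff_archKTypeOfSlotTwoAt_of_embedding_eqG (h : (InfinitePlace.mk ι₁).embedding = ι₁) :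
    (archKTypeOfSlotTwoAtG hHD hI h₁ h₃ V c hGR hGR₀ hGR₁ hGR₂ hGR₃ η₀ η₁ η₂ η₃ hmaj hrat A hV N Γ₀ hlevel Φ₂ eR eS xr harch hfin
        hsec hχ).IsWeaklyPDiff BallForms.expP := by
  have e : (fun b => twistU21 L ι₁ (BallForms.expP b)) = BallForms.expP := funext fun b => twistU21_eq_self_of_embedding_eq h _
  rw [← e]
  exact isWeaklyPDiff_archKTypeOfSlotTwoAt_twistG hHD hI h₁ h₃ V c hGR hGR₀ hGR₁ hGR₂ hGR₃ η₀ η₁ η₂ η₃ hmaj hrat A hV N Γ₀ hlevel Φ₂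
    eR eS xr harch hfin hsec hχ

/-- **ROW 15 FOR LINE 2 AT THE CENTRE `xr`, ALONG `expP` ITSELF**, in the branch `(mk ι₁).embedding = ι₁`. -/
theorem isPMinusKilledAlong_archKTypeOfSlotTwoAt_of_embedding_eqG (h : (InfinitePlace.mk ι₁).embedding = ι₁) (p : Fin 2) :
    (archKTypeOfSlotTwoAtG hHD hI h₁ h₃ V c hGR hGR₀ hGR₁ hGR₂ hGR₃ η₀ η₁ η₂ η₃ hmaj hrat A hV N Γ₀ hlevel Φ₂ eR eS xr harch hfin
        hsec hχ).IsPMinusKilledAlong BallForms.expP (-Complex.I • (Pi.single p 1 : Fin 2 → ℂ)) := by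
  have e : (fun b => twistU21 L ι₁ (BallForms.expP b)) = BallForms.expP := funext fun b => twistU21_eq_self_of_embedding_eq h _
  rw [← e]
  exact isPMinusKilledAlong_archKTypeOfSlotTwoAt_twistG hHD hI h₁ h₃ V c hGR hGR₀ hGR₁ hGR₂ hGR₃ η₀ η₁ η₂ η₃ hmaj hrat A hV N Γ₀
    hlevel Φ₂ eR eS xr harch hfin hsec hχ p

end TwoAt

/-! ### line 3 at an arbitrary centre -/

section ThreeAt

variable
  (eR : PosIdx (cmXW (L : Type) (frameD V) (lineVec (L : Type) (dW' c.D 1)) (fun _ => dW'_real c.D 1) ι₁ (cmPlace (L : Type) ι₁)) ≃ Unit)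
  (eS : NegIdx (cmXW (L : Type) (frameD V) (lineVec (L : Type) (dW' c.D 1)) (fun _ => dW'_real c.D 1) ι₁ (cmPlace (L : Type) ι₁)) ≃ Empty)
  (xr : Fin 3 → ↥(maximalRealSubfield L))
  (harch : ∀ a : UnitaryGroup.arch (↥(maximalRealSubfield L)) L (IsCMField.complexConj L) 3 V.Hm,
    UnitaryGroup.archAt (↥(maximalRealSubfield L)) L (IsCMField.complexConj L) 3 V.Hm (UnitaryGroup.cmPlace (L : Type) ι₁)
        (NumberField.complexConj_smul_infinitePlace (L : Type) _) (IsCMField.complexConj_ne_one (L : Type)) a = 1 →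
    ∀ ℓ, ((archSideOfChar V c hGR hGR₀ hGR₁ hGR₂ hGR₃ η₀ η₁ η₂ η₃ hmaj hrat A).P 3).ω
        (HodgeCM.Adelic.regimeEquiv L V.Hm hV
          (UnitaryGroup.archToAdelic (↥(maximalRealSubfield L)) L (IsCMField.complexConj L) 3 V.Hm a), 1)
        (testFun (↥(maximalRealSubfield L)) (Fin 3)
          (blockFamilyOfAt (L : Type) e₁ (frameD V) (frameD_real V) (frameD_ne V) (lineVec (L : Type) (dW' c.D 1))
            (fun _ => dW'_real c.D 1) (fun _ => dW'_ne c.D 1) ι₁ (blockPosEquiv V) (blockNegEquiv V) eR eS (degOnePDual Empty) Φ₂ ℓ)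
          xr N) =
      testFun (↥(maximalRealSubfield L)) (Fin 3)
        (blockFamilyOfAt (L : Type) e₁ (frameD V) (frameD_real V) (frameD_ne V) (lineVec (L : Type) (dW' c.D 1))
          (fun _ => dW'_real c.D 1) (fun _ => dW'_ne c.D 1) ι₁ (blockPosEquiv V) (blockNegEquiv V) eR eS (degOnePDual Empty) Φ₂ ℓ) xr N)
  (hfin : ∀ kf : UnitaryGroup.finAdelic (↥(maximalRealSubfield L)) L (IsCMField.complexConj L) 3 V.Hm, kf ∈ Γ₀.K →
    ∀ Φinf : 𝓢((Fin 3 → mixedSpace (↥(maximalRealSubfield L))), ℂ),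
      ((archSideOfChar V c hGR hGR₀ hGR₁ hGR₂ hGR₃ η₀ η₁ η₂ η₃ hmaj hrat A).P 3).ω
          (HodgeCM.Adelic.regimeEquiv L V.Hm hV
            (UnitaryGroup.finAdelicToAdelic (↥(maximalRealSubfield L)) L (IsCMField.complexConj L) 3 V.Hm kf), 1)
          (testFun (↥(maximalRealSubfield L)) (Fin 3) Φinf xr N) =
        testFun (↥(maximalRealSubfield L)) (Fin 3) Φinf xr N)
  (hsec : ∀ u : stabilizer U21 x₀,
    cmBlockSectionAt (L : Type) (frameD V) (frameD_real V) (frameD_ne V) (lineVec (L : Type) (dW' c.D 1)) (fun _ => dW'_real c.D 1)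
        (fun _ => dW'_ne c.D 1) ι₁ (cmPlace (L : Type) ι₁) (blockPosEquiv V) (blockNegEquiv V) eR eS (u21FrameEquiv (u : U21), 1) =
      (archSectionFrameOf V u, 1))
  (hχ : ∀ u : stabilizer U21 x₀,
    ((lineScalar_three V c.D hGR hGR₂ hGR₃ η₃ (u : U21) : ℂˣ) : ℂ) *
        ((matA (stabilizerEquivK21.symm u)).det ^ (lineVacExponentsThree V c hGR₃ eR eS).eP *
          sclD (stabilizerEquivK21.symm u) ^ (lineVacExponentsThree V c hGR₃ eR eS).eQ) =
      star (sclD (stabilizerEquivK21.symm u)))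

/-- **ROW 12 FOR LINE 3 IN THE LITERAL SLOT** — `Φarch := blockFamilyOfAt … eR eS (degOnePDual Empty) Φ₂`; (Φ) discharged. -/
def archKTypeOfSlotThreeAtG :
    ArchKTypeDataAt (thetaSpaceInputIn hHD hI h₁ h₃ (archSideOfChar V c hGR hGR₀ hGR₁ hGR₂ hGR₃ η₀ η₁ η₂ η₃ hmaj hrat A) hV) 3
      (finEmb (↥(maximalRealSubfield L)) (Fin 3) xr) (Ideal.span {((N : ℕ) : 𝓞 (↥(maximalRealSubfield L)))}) :=
  archKTypeOfAt hHD hI h₁ h₃ (archSideOfChar V c hGR hGR₀ hGR₁ hGR₂ hGR₃ η₀ η₁ η₂ η₃ hmaj hrat A) hV 3 xr N Γ₀ Γ₀.K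
    (satLevelRegimeOf_le_archFinOf V hV Γ₀.K) hlevel (fun _ hg => hg)
    (lineOmega_three V c.D hGR hGR₂ hGR₃ η₃)
    (fun g => lineRepOf_three_archInfOf_eq V c.D hGR hGR₀ hGR₁ hGR₂ hGR₃ η₀ η₁ η₂ η₃ hV g)
    (blockFamilyOfAt (L : Type) e₁ (frameD V) (frameD_real V) (frameD_ne V) (lineVec (L : Type) (dW' c.D 1)) (fun _ => dW'_real c.D 1)
      (fun _ => dW'_ne c.D 1) ι₁ (blockPosEquiv V) (blockNegEquiv V) eR eS (degOnePDual Empty) Φ₂)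
    (satLevel_fix_of_arch_of_fin_family (archSideOfChar V c hGR hGR₀ hGR₁ hGR₂ hGR₃ η₀ η₁ η₂ η₃ hmaj hrat A) hV 3 Γ₀.K
      (fun ℓ => testFun (↥(maximalRealSubfield L)) (Fin 3)
        (blockFamilyOfAt (L : Type) e₁ (frameD V) (frameD_real V) (frameD_ne V) (lineVec (L : Type) (dW' c.D 1)) (fun _ => dW'_real c.D 1)
      (fun _ => dW'_ne c.D 1) ι₁ (blockPosEquiv V) (blockNegEquiv V) eR eS (degOnePDual Empty) Φ₂ ℓ) xr N)
      harch (fun kf hkf _ => hfin kf hkf _))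
    (smulPull_blockFamilyOfAt_harm V e₁ (lineVec (L : Type) (dW' c.D 1)) (fun _ => dW'_real c.D 1) (fun _ => dW'_ne c.D 1) hGR₃
      (lineScalar_three V c.D hGR hGR₂ hGR₃ η₃) eR eS (degOnePDual Empty) Φ₂ hsec
      (fun kk Φ => cmBlockRepAt_κ_tensorPi_lineVacExponentsThree V c hGR₃ eR eS kk Φ Φ₂)
      (unitaryOpPi_dualPairι_degOnePDual Empty) hχ)

/-- `ωinf` of the slot term is `lineOmega_three` (#CA1v4 `archKTypeOf_ωinf_apply`). -/
theorem archKTypeOfSlotThreeAt_ωinf_applyG (g : U21) (Φ : 𝓢((Fin 3 → mixedSpace (↥(maximalRealSubfield L))), ℂ)) :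
    (archKTypeOfSlotThreeAtG hHD hI h₁ h₃ V c hGR hGR₀ hGR₁ hGR₂ hGR₃ η₀ η₁ η₂ η₃ hmaj hrat A hV N Γ₀ hlevel Φ₂ eR eS xr harch hfin
        hsec hχ).ωinf g Φ = lineOmega_three V c.D hGR hGR₂ hGR₃ η₃ g Φ :=
  rfl

/-- `Φarch` of the slot term (rfl). -/
theorem archKTypeOfSlotThreeAt_ΦarchG :
    (archKTypeOfSlotThreeAtG hHD hI h₁ h₃ V c hGR hGR₀ hGR₁ hGR₂ hGR₃ η₀ η₁ η₂ η₃ hmaj hrat A hV N Γ₀ hlevel Φ₂ eR eS xr harch hfin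
        hsec hχ).Φarch =
      blockFamilyOfAt (L : Type) e₁ (frameD V) (frameD_real V) (frameD_ne V) (lineVec (L : Type) (dW' c.D 1)) (fun _ => dW'_real c.D 1)
        (fun _ => dW'_ne c.D 1) ι₁ (blockPosEquiv V) (blockNegEquiv V) eR eS (degOnePDual Empty) Φ₂ :=
  rfl

/-- the intertwining identity `hτ` of BRICK 4 for the slot term along `twistU21 ∘ expP`, `τ := F⁻¹`. -/
theorem archKTypeOfSlotThreeAt_hτG (b : Fin 2 → ℂ)
    (x : SchwartzMap (DPIdx (Fin 2) Unit Unit Empty ⊕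
      (Fin 3 × {w : {w : InfinitePlace ↥(maximalRealSubfield L) // w.IsReal} // w ≠ cmPlace (L : Type) ι₁}) → ℝ) ℂ) :
    (archKTypeOfSlotThreeAtG hHD hI h₁ h₃ V c hGR hGR₀ hGR₁ hGR₂ hGR₃ η₀ η₁ η₂ η₃ hmaj hrat A hV N Γ₀ hlevel Φ₂ eR eS xr harch hfin
        hsec hχ).ωinf (twistU21 L ι₁ (BallForms.expP b))
        (((cmBlockFrameAt (L : Type) e₁ (frameD V) (frameD_real V) (frameD_ne V) (lineVec (L : Type) (dW' c.D 1))
          (fun _ => dW'_real c.D 1) (fun _ => dW'_ne c.D 1) ι₁ (cmPlace (L : Type) ι₁) (blockPosEquiv V) (blockNegEquiv V) eR eS).symm :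
            _ ≃L[ℂ] _) x) =
      ((cmBlockFrameAt (L : Type) e₁ (frameD V) (frameD_real V) (frameD_ne V) (lineVec (L : Type) (dW' c.D 1))
          (fun _ => dW'_real c.D 1) (fun _ => dW'_ne c.D 1) ι₁ (cmPlace (L : Type) ι₁) (blockPosEquiv V) (blockNegEquiv V) eR eS).symm :
            _ ≃L[ℂ] _)
        (cmBlockRepAt (L : Type) e₁ (frameD V) (frameD_real V) (frameD_ne V) (lineVec (L : Type) (dW' c.D 1)) (fun _ => dW'_real c.D 1)
          (fun _ => dW'_ne c.D 1) hGR₃ ι₁ (cmPlace (L : Type) ι₁) (blockPosEquiv V) (blockNegEquiv V) eR eS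
          (cmBlockSectionAt (L : Type) (frameD V) (frameD_real V) (frameD_ne V) (lineVec (L : Type) (dW' c.D 1))
            (fun _ => dW'_real c.D 1) (fun _ => dW'_ne c.D 1) ι₁ (cmPlace (L : Type) ι₁) (blockPosEquiv V) (blockNegEquiv V) eR eS
            (((u21FrameEquiv (BallForms.expP b) : UForm (Fin 2) Unit), (1 : UForm Unit Empty)) : Ginf (Fin 2) Unit Unit Empty)) x) := by
  rw [archKTypeOfSlotThreeAt_ωinf_applyG, lineOmega_three_twistU21_expP_AtG, cmArchWeilRep_cmBlockFrameAt_symm]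

set_option backward.isDefEq.respectTransparency false in
/-- **ROW 14 FOR LINE 3 IN THE LITERAL SLOT — NO HYPOTHESIS BEYOND THE TERM'S INPUTS.** -/
theorem isWeaklyPDiff_archKTypeOfSlotThreeAt_twistG :
    (archKTypeOfSlotThreeAtG hHD hI h₁ h₃ V c hGR hGR₀ hGR₁ hGR₂ hGR₃ η₀ η₁ η₂ η₃ hmaj hrat A hV N Γ₀ hlevel Φ₂ eR eS xr harch hfin
        hsec hχ).IsWeaklyPDiff (fun b => twistU21 L ι₁ (BallForms.expP b)) := by
  obtain ⟨ω₁, hW₁, hc₁⟩ := exists_isArchWeilDatum_lineSlot (R := Unit) (S := Empty)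
  obtain ⟨ev₁, hvac₁⟩ := (junction (Fin 2) Unit Unit Empty).exists_vacExponents hW₁
  exact ArchKTypeDataAt.isWeaklyPDiff_of_blockPair
    (X := thetaSpaceInputIn hHD hI h₁ h₃ (archSideOfChar V c hGR hGR₀ hGR₁ hGR₂ hGR₃ η₀ η₁ η₂ η₃ hmaj hrat A) hV) _
    (isArchWeilDatum_cmBlockAt (L : Type) e₁ (frameD V) (frameD_real V) (frameD_ne V) (lineVec (L : Type) (dW' c.D 1))
      (fun _ => dW'_real c.D 1) (fun _ => dW'_ne c.D 1) hGR₃ ι₁ (cmPlace (L : Type) ι₁) (blockPosEquiv V) (blockNegEquiv V) eR eS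
      (frameD_sign_ι₁' V) (line_hs₁W_of_real (dW'_real c.D 1) (dW'_ne c.D 1)) (frameD_sign_of_ne V) (fun τ hτ => line_hsW (dW' c.D 1) τ hτ))
    (continuous_cmBlockRepAt (L : Type) e₁ (frameD V) (frameD_real V) (frameD_ne V) (lineVec (L : Type) (dW' c.D 1))
      (fun _ => dW'_real c.D 1) (fun _ => dW'_ne c.D 1) hGR₃ ι₁ (cmPlace (L : Type) ι₁) (blockPosEquiv V) (blockNegEquiv V) eR eS)
    hW₁ hc₁ hvac₁
    (cmBlockSectionAt (L : Type) (frameD V) (frameD_real V) (frameD_ne V) (lineVec (L : Type) (dW' c.D 1)) (fun _ => dW'_real c.D 1)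
      (fun _ => dW'_ne c.D 1) ι₁ (cmPlace (L : Type) ι₁) (blockPosEquiv V) (blockNegEquiv V) eR eS)
    (continuous_cmBlockSectionAt (L : Type) (frameD V) (frameD_real V) (frameD_ne V) (lineVec (L : Type) (dW' c.D 1))
      (fun _ => dW'_real c.D 1) (fun _ => dW'_ne c.D 1) ι₁ (cmPlace (L : Type) ι₁) (blockPosEquiv V) (blockNegEquiv V) eR eS)
    (coe_cmBlockPhaseHomAt_cmBlockSectionAt (L : Type) e₁ (frameD V) (frameD_real V) (frameD_ne V) (lineVec (L : Type) (dW' c.D 1))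
      (fun _ => dW'_real c.D 1) (fun _ => dW'_ne c.D 1) ι₁ (cmPlace (L : Type) ι₁) (blockPosEquiv V) (blockNegEquiv V) eR eS)
    (fun b => twistU21 L ι₁ (BallForms.expP b))
    ((cmBlockFrameAt (L : Type) e₁ (frameD V) (frameD_real V) (frameD_ne V) (lineVec (L : Type) (dW' c.D 1)) (fun _ => dW'_real c.D 1)
      (fun _ => dW'_ne c.D 1) ι₁ (cmPlace (L : Type) ι₁) (blockPosEquiv V) (blockNegEquiv V) eR eS).symm.toContinuousLinearMap)
    (archKTypeOfSlotThreeAt_hτG hHD hI h₁ h₃ V c hGR hGR₀ hGR₁ hGR₂ hGR₃ η₀ η₁ η₂ η₃ hmaj hrat A hV N Γ₀ hlevel Φ₂ eR eS xr harch hfin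
      hsec hχ)
    Φ₂ (degOnePDual Empty) (fun _ => rfl)


-- port_pkg: scope closed for this part
end ThreeAt
end Slot
end HodgeCM.Model
end
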